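import Summits.BirchSwinnertonDyer.BirchSwinnertonDyer.Theorems.ManinLocalTwoThreeNegOneTwistConductorAtTwo
import Summits.BirchSwinnertonDyer.Rank1Residual.ManinAdditive.MinusOneLevelRaisingOptimalPartnerProof
import Literature.NumberTheory.EllipticCurves.SzpiroLocalDataProofs
import Literature.NumberTheory.EllipticCurves.QuadraticTwistIntegralModel
import Literature.NumberTheory.EllipticCurves.QuadraticTwistMinimalModelProofs
import Literature.NumberTheory.EllipticCurves.RootNumberSmulProofs
import HarnessLib

/-!
# S-an-58 in CONDUCTOR-NORM form: `4 ∥ N(W) ⟹ N(W ⊗ χ₋₄) = 4·N(W)`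
# — an's node `NegOneTwistConductorFourMul` DISCHARGED BY NAME, hence S-an-57 and «C2|_{8∣N} ⟹ C2|_{4∥N}» modulo modularity only
# (route `ManinLocalTwoThree`, crux C2 `ManinOddAtFour` stmt-BirchSwinnertonDyer-22967; cell bsd-f2-manin, an g32 MEMO-an §75.7–75.9, typer B3
# `…/ManinAdditive/MinusOneLevelRaisingOptimalPartnerProof.lean` p695548; p2 gen 13)

The BODY of an's S-an-58 node, PROVED: at `2` the exponent goes `2 ↦ 4` (this seat's
`padicValNat_two_conductorNorm_quadraticTwist_negOne_of_eq_two`, Tate's algorithm over `ℤ₂`, Barrios et al. 2025 Thm. 5.1 rows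
IV/IV*), and off `2` the twist by `−1 = 4·(−1/2) + 1` is unramified so `f_v` is unchanged (§0, a route-independent copy of
the `dyadic-twist` line's `maninLocalTwoThree_conductorExponent_quadraticTwist_eq_of_ne_two` at `d = −1`: `twistModel (−1/2)` +
`conductorExponent_twistModel`); the conductor is `∏ p^{f_p}` (`factorization_conductorNorm_primesEquiv_symm`).  §2 then discharges the node BY NAME (`negOneTwistConductorFourMul_holds`) and
re-exports an's B3 theorems without their `h58` hypothesis: S-an-57 `MinusOneLevelRaisingOptimalPartner` modulo `exists_isNewformOf`
only, and the conductor-level reduction «`2 ∤ c` on every lattice-optimal datum with `8 ∣ N` ⟹ the same with `4 ∣ N`».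

HONEST FRAMING: local/global conductor bookkeeping in print, now kernel-checked; ref1 §R125's
`NegOneTwistConductorFourMul → (ManinOddAtFour ↔ ManinOddAtEight)` loses its print hypothesis.  BSD is not proved; Manin's
conjecture is not proved; C2 OPEN (its `8 ∣ N` stratum is untouched).
[cite: BarriosEtAl2025, Thm. 5.1, rows IV / IV*] [cite: SilvermanAEC2009, C.16 (the conductor as ∏ p^{f_p})]
-/

set_option autoImplicit false
-- lint-debt: the directory name repeats the summit name (sibling precedent `ManinLocalTwoThreeNegOneTwistConductorAtTwo.lean`)
set_option linter.dupNamespace false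

noncomputable section

open scoped Classical
open WeierstrassCurve IsDedekindDomain IsDedekindDomain.HeightOneSpectrum Rat.HeightOneSpectrum
  Literature.NumberTheory.DiophantineGeometry Literature.NumberTheory.EllipticCurves Literature.NumberTheory.EllipticCurves.ModularForms
  Summit.BirchSwinnertonDyer.Rank1Residual.ManinAdditive

namespace Summit.BirchSwinnertonDyer.BirchSwinnertonDyer.Theorems.ManinLocalTwoThree

/-! ## §0 Off `2` the twist by `−1` does not move `f_v` (route-independent copy) -/

/-- **`f_v(V ⊗ (−1)) = f_v(V)` at every place `v ∤ 2`.**  The twist by `−1 = 4k + 1`, `k = −1/2`, is unramified at an odd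
place `v` (`|k|_v ≤ 1`, `|−1|_v = 1`): `V ⊗ (−1) ≅ V.twistModel k` (`exists_variableChange_twistModel_eq_quadraticTwist`),
`f_v(V.twistModel k) = f_v(V)` (`conductorExponent_twistModel`), and `f_v` is an isomorphism invariant (`conductorExponent_smul'`).
(The `dyadic-twist` line's `maninLocalTwoThree_conductorExponent_quadraticTwist_eq_of_ne_two` at `d = −1`, restated here so that this
file does not sit in the route file's import cone.) [cite: SilvermanATAEC1994, IV.9.4 (PDF pp. 344–346)] -/
theorem conductorExponent_quadraticTwist_negOne_eq_of_ne_two (V : WeierstrassCurve ℚ) [V.IsElliptic] (v : HeightOneSpectrum ℤ)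
    (hv : natGenerator v ≠ 2) :
    (V.quadraticTwist ((-1 : ℤ) : ℚ)).conductorExponent v = V.conductorExponent v := by
  have hgen : (natGenerator v).Prime := prime_natGenerator v
  have hd0 : ((-1 : ℤ) : ℚ) ≠ 0 := by norm_num
  -- `|−1|_v = 1`
  have hdv : v.valuation ℚ ((-1 : ℤ) : ℚ) = 1 := by
    rw [Literature.NumberTheory.EllipticCurves.Rat.valuation_intCast_eq_one_iff]
    intro h
    have h1 : (natGenerator v : ℤ) ∣ 1 := dvd_neg.mp h
    have h1' : natGenerator v ∣ 1 := by exact_mod_cast h1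
    exact hgen.ne_one (Nat.dvd_one.mp h1')
  -- `|4|_v = 1`
  have h4v : v.valuation ℚ (4 : ℚ) = 1 := by
    rw [show (4 : ℚ) = ((4 : ℤ) : ℚ) by norm_num, Literature.NumberTheory.EllipticCurves.Rat.valuation_intCast_eq_one_iff]
    intro h
    have h2 : (natGenerator v : ℤ) ∣ 2 ^ 2 := by simpa using h
    have h2' : (natGenerator v : ℤ) ∣ 2 := (Nat.prime_iff_prime_int.mp hgen).dvd_of_dvd_pow h2
    have h2'' : natGenerator v ∣ 2 := by exact_mod_cast h2'
    exact hv ((Nat.prime_dvd_prime_iff_eq hgen Nat.prime_two).mp h2'')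
  set k : ℚ := (((-1 : ℤ) : ℚ) - 1) / 4 with hk_def
  have hk4 : 4 * k + 1 = ((-1 : ℤ) : ℚ) := by rw [hk_def]; ring
  have hkv : v.valuation ℚ k ≤ 1 := by
    rw [hk_def, map_div₀, h4v, div_one,
      show (((-1 : ℤ) : ℚ) - 1) = algebraMap ℤ ℚ (-1 - 1) by rw [eq_intCast]; push_cast; ring]
    exact HeightOneSpectrum.valuation_le_one v (-1 - 1)
  have hk1 : v.valuation ℚ (4 * k + 1) = 1 := by rw [hk4]; exact hdv
  obtain ⟨C₁, -, hC₁⟩ := exists_variableChange_twistModel_eq_quadraticTwist V k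
  rw [hk4] at hC₁
  haveI : (V.twistModel k).IsElliptic := by
    refine ⟨?_⟩
    rw [twistModel_Δ, hk4]
    exact (IsUnit.mk0 _ (pow_ne_zero 6 hd0)).mul V.isUnit_Δ
  haveI : (V.quadraticTwist ((-1 : ℤ) : ℚ)).IsElliptic := V.isElliptic_quadraticTwist hd0
  rw [← hC₁, conductorExponent_smul']
  exact conductorExponent_twistModel v V hkv hk1

/-! ## §1 The conductor-norm form of S-an-58 -/

/-- `ord₂ 4 = 2` on the factorization side. [folklore] -/
theorem factorization_four_two : (4 : ℕ).factorization 2 = 2 := by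
  rw [show (4 : ℕ) = 2 ^ 2 by norm_num, Nat.Prime.factorization_pow Nat.prime_two, Finsupp.single_eq_same]

/-- `ord_p 4 = 0` for `p ≠ 2`. [folklore] -/
theorem factorization_four_of_ne_two {p : ℕ} (hp : p ≠ 2) : (4 : ℕ).factorization p = 0 := by
  rw [show (4 : ℕ) = 2 ^ 2 by norm_num, Nat.Prime.factorization_pow Nat.prime_two, Finsupp.single_apply,
    if_neg (Ne.symm hp)]

/-- **S-an-58 `NegOneTwistConductorFourMul` (an g32, MEMO-an §75.8), PROVED: `4 ∥ N(W) ⟹ N(W ⊗ (−1)) = 4·N(W)`.**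
At `2`: `f₂ = 2 ↦ 4` (Tate's algorithm, this lineage's `padicValNat_two_conductorNorm_quadraticTwist_negOne_of_eq_two`);
off `2`: `f_p` unchanged (unramified twist); conclude by unique factorization.
[cite: BarriosEtAl2025, Thm. 5.1, rows IV / IV*] [cite: SilvermanAEC2009, C.16] -/
theorem conductorNorm_quadraticTwist_negOne_eq_four_mul (W : WeierstrassCurve ℚ) [W.IsElliptic]
    (h4 : 2 ^ 2 ∣ W.conductorNorm ℤ) (h8 : ¬ 2 ^ 3 ∣ W.conductorNorm ℤ) :
    (haveI := W.isElliptic_quadraticTwist (show ((-1 : ℤ) : ℚ) ≠ 0 by norm_num);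
      (W.quadraticTwist ((-1 : ℤ) : ℚ)).conductorNorm ℤ) = 4 * W.conductorNorm ℤ := by
  haveI : Fact (Nat.Prime 2) := ⟨Nat.prime_two⟩
  have hd0 : ((-1 : ℤ) : ℚ) ≠ 0 := by norm_num
  haveI := W.isElliptic_quadraticTwist hd0
  have hN0 : W.conductorNorm ℤ ≠ 0 := (conductorNorm_pos_holds W).ne'
  have hN0' : (W.quadraticTwist ((-1 : ℤ) : ℚ)).conductorNorm ℤ ≠ 0 := (conductorNorm_pos_holds _).ne'
  -- `ord₂ N = 2` and `ord₂ N′ = 4`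
  have h2 : (W.conductorNorm ℤ).factorization 2 = 2 := by
    rw [Nat.prime_two.pow_dvd_iff_le_factorization hN0] at h4 h8
    omega
  have h2' : ((W.quadraticTwist ((-1 : ℤ) : ℚ)).conductorNorm ℤ).factorization 2 = 4 := by
    rw [Nat.factorization_def _ Nat.prime_two]
    exact padicValNat_two_conductorNorm_quadraticTwist_negOne_of_eq_two W
      (by rw [← Nat.factorization_def _ Nat.prime_two]; exact h2)
  -- compare factorizations prime by prime
  show (W.quadraticTwist ((-1 : ℤ) : ℚ)).conductorNorm ℤ = 4 * W.conductorNorm ℤ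
  refine Nat.eq_of_factorization_eq hN0' (mul_ne_zero (by norm_num) hN0) fun p ↦ ?_
  rw [Nat.factorization_mul (by norm_num : (4 : ℕ) ≠ 0) hN0, Finsupp.add_apply]
  by_cases hp : p.Prime
  swap
  · rw [Nat.factorization_eq_zero_of_not_prime _ hp, Nat.factorization_eq_zero_of_not_prime _ hp,
      Nat.factorization_eq_zero_of_not_prime _ hp]
  by_cases hp2 : p = 2
  · subst hp2
    rw [h2', h2, factorization_four_two]
  · -- odd prime `p`: the twist by `−1` is unramified at `p`
    rw [factorization_four_of_ne_two hp2, zero_add]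
    have e1 := factorization_conductorNorm_primesEquiv_symm W ⟨p, hp⟩
    have e2 := factorization_conductorNorm_primesEquiv_symm (W.quadraticTwist ((-1 : ℤ) : ℚ)) ⟨p, hp⟩
    simp only at e1 e2
    rw [e1, e2]
    exact conductorExponent_quadraticTwist_negOne_eq_of_ne_two W _
      (by rw [Literature.NumberTheory.EllipticCurves.Rat.natGenerator_primesEquiv_symm ⟨p, hp⟩]; exact hp2)

/-- **Corollary (the stratum form used by an's S-an-57 / ref1 §R125): `4 ∥ N(W) ⟹ 8 ∣ N(W ⊗ (−1))`, indeed `16 ∣`.**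
[cite: BarriosEtAl2025, Thm. 5.1, rows IV / IV*] -/
theorem sixteen_dvd_conductorNorm_quadraticTwist_negOne (W : WeierstrassCurve ℚ) [W.IsElliptic]
    (h4 : 2 ^ 2 ∣ W.conductorNorm ℤ) (h8 : ¬ 2 ^ 3 ∣ W.conductorNorm ℤ) :
    (haveI := W.isElliptic_quadraticTwist (show ((-1 : ℤ) : ℚ) ≠ 0 by norm_num);
      2 ^ 4 ∣ (W.quadraticTwist ((-1 : ℤ) : ℚ)).conductorNorm ℤ) := by
  have h := conductorNorm_quadraticTwist_negOne_eq_four_mul W h4 h8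
  rw [h, show (2 : ℕ) ^ 4 = 4 * 2 ^ 2 by norm_num]
  exact Nat.mul_dvd_mul_left 4 h4

/-! ## §2 The node discharged by name, and an's B3 theorems without the print hypothesis -/

/-- **S-an-58 `NegOneTwistConductorFourMul` HOLDS** (an g32 MEMO-an §75.8; typer B3 p695548): the node is a theorem of the tree.
[cite: BarriosEtAl2025, Thm. 5.1, rows IV / IV*] -/
theorem negOneTwistConductorFourMul_holds : Summit.BirchSwinnertonDyer.Rank1Residual.ManinAdditive.NegOneTwistConductorFourMul :=
  fun W _ h4 h8 ↦ conductorNorm_quadraticTwist_negOne_eq_four_mul W h4 h8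

/-- **S-an-57 `MinusOneLevelRaisingOptimalPartner` modulo modularity ONLY** (`exists_isNewformOf`, a frame hypothesis C2 already
carries): an's `minusOneLevelRaisingOptimalPartner_of` with S-an-58 discharged. [cite: Pal2012, Lemma 3.1 and Prop. 2.4]
[cite: Stevens1989, Lemma (5.4) p. 97] -/
theorem minusOneLevelRaisingOptimalPartner_of_modularity (hnf : exists_isNewformOf) :
    Summit.BirchSwinnertonDyer.Rank1Residual.ManinAdditive.MinusOneLevelRaisingOptimalPartner :=
  Summit.BirchSwinnertonDyer.Rank1Residual.ManinAdditive.minusOneLevelRaisingOptimalPartner_of hnf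
    negOneTwistConductorFourMul_holds

/-- **C2 at the conductor level: the `4 ∥ N` stratum follows from the `8 ∣ N` stratum, modulo modularity only** — an's
`two_not_dvd_c_of_four_dvd_of_eight_dvd_stratum_of_modularity` with S-an-58 discharged: if `2 ∤ c` for every lattice-optimal
conductor-level datum of a minimal curve with `8 ∣ N`, then `2 ∤ c` for every such datum with `4 ∣ N`.
[cite: Pal2012, Lemma 3.1 and Prop. 2.4] [cite: Stevens1989, Lemma (5.4) p. 97] -/
theorem two_not_dvd_c_of_four_dvd_of_eight_dvd_stratum_of_modularity' (hnf : exists_isNewformOf)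
    (h8 : ∀ (W' : WeierstrassCurve ℚ) [W'.IsElliptic] [W'.IsGloballyMinimal] [NeZero (W'.conductorNorm ℤ)]
      (D' : ModularParametrizationData W' (W'.conductorNorm ℤ)),
      IsLatticeOptimal D' → 2 ^ 3 ∣ W'.conductorNorm ℤ → ¬ (2 : ℤ) ∣ D'.c)
    (W : WeierstrassCurve ℚ) [W.IsElliptic] [W.IsGloballyMinimal] [NeZero (W.conductorNorm ℤ)]
    (D : ModularParametrizationData W (W.conductorNorm ℤ)) (hD : IsLatticeOptimal D)
    (h4 : 2 ^ 2 ∣ W.conductorNorm ℤ) : ¬ (2 : ℤ) ∣ D.c :=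
  Summit.BirchSwinnertonDyer.Rank1Residual.ManinAdditive.two_not_dvd_c_of_four_dvd_of_eight_dvd_stratum_of_modularity hnf
    negOneTwistConductorFourMul_holds h8 W D hD h4

/-- **The lattice-optimal `χ₋₄`-partner at conductor `4N` with `c′ = ± c`, modulo modularity only** — an's
`exists_optimalPartner_c_eq_or` with S-an-58 discharged. [cite: Pal2012, Lemma 3.1 and Prop. 2.4] -/
theorem exists_optimalPartner_c_eq_or_of_modularity (hnf : exists_isNewformOf)
    (W : WeierstrassCurve ℚ) [W.IsElliptic] [W.IsGloballyMinimal] [NeZero (W.conductorNorm ℤ)]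
    (D : ModularParametrizationData W (W.conductorNorm ℤ)) (hD : IsLatticeOptimal D)
    (h4 : 2 ^ 2 ∣ W.conductorNorm ℤ) (h8 : ¬ 2 ^ 3 ∣ W.conductorNorm ℤ) :
    ∃ (W' : WeierstrassCurve ℚ) (_ : W'.IsElliptic) (_ : W'.IsGloballyMinimal)
      (_ : NeZero (W'.conductorNorm ℤ)) (D' : ModularParametrizationData W' (W'.conductorNorm ℤ)),
      IsLatticeOptimal D' ∧ W'.conductorNorm ℤ = 4 * W.conductorNorm ℤ ∧ (D'.c = D.c ∨ D'.c = -D.c) :=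
  Summit.BirchSwinnertonDyer.Rank1Residual.ManinAdditive.exists_optimalPartner_c_eq_or hnf negOneTwistConductorFourMul_holds
    W D hD h4 h8

end Summit.BirchSwinnertonDyer.BirchSwinnertonDyer.Theorems.ManinLocalTwoThree

end
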